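import Mathlib
import HarnessLib
import Summits.HubbardSuperconductivity.HubbardSuperconductivity.Theorems.KLProgrammeKLRegimeEngineDressedAliasing
import Summits.HubbardSuperconductivity.HubbardSuperconductivity.Theorems.KLProgrammeKLRegimeTwoVolumeFrameMismatchResponseDoor
import Summits.HubbardSuperconductivity.HubbardSuperconductivity.Theorems.KLProgrammeKLRegimeEngineCovarianceResponseAtPoint
import Summits.HubbardSuperconductivity.HubbardSuperconductivity.Theorems.KLProgrammeKLRegimeEngineFrameShiftMomentResponseCTSplit

/-!
# K3 gen-8-FLOW (stmt 20437, stub (C), «(C)-B-REP» sup route S-d, model layer): the TREE jets `A, A′` and the DRESSING jets `A_J` of the corrected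
# (B) door (`…EngineFrameShiftResponseDoorCT(Mismatch)`, hypotheses `hT`, `hJ`) ARE PURE ALIASING — `≤ 4·[dressed aliasing bound]`, `tiny(L)`

Cell gate-hubbard-kl, seat p2 g14 (pen (R59ap) two channels / (R59bl) owner split; memo SUP-ROUTE-SPEC §2(d)).  The per-functional door
`covRespCT_readingJet_sub_le` (p2 g13) leaves the tree data `T_t = ¼Σ_σΣ_{i=i₁,i₂} Σ[(𝒲_t,𝒲_t)_ḋ]((i,·),σ)` and the dressing data
`J = ¼Σ_σΣ_{i∈I} Re(A_i + B_i·Σ′_i)` as jet hypotheses `A, A′, A_J` at the reading point `q`.  With ABSTRACT symbols `s₀, s₁` (defect `ḋ = normalCovariance (s₁ − s₀)`)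
and the identification hypotheses `s₁ − s₀ = g_i∘p`, `A_i = a_i∘p`, `B_i = b_i∘p` for continuum factors `g_i, a_i, b_i : Momentum → ℂ` that are smooth,
`2π`-periodic, `D₄`-symmetric and VANISH NEAR `q`, this file bounds all three by the dressed aliasing lemma (`…EngineDressedAliasing`, p578694):

* §1 `selfEnergy_derivPairing_eq` — the tree term is a product: `Σ[(𝒲_t,𝒲_t)_ḋ]((i,k),σ) = g_i(p_k)·2βL²·4·R_t((i,k),σ)²` (`covRespCT_kernel_two_pairing_eq`,
  `normalCovariance_linePath/_sub`); moments of `C·R²` from moments of `R` (`momentSum_const_mul_sq_le`, Young `sum_mul_norm_torusFourierInv_mul_le`),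
  of a constant lattice factor (`momentSum_torusFourierInv_const`, via p561071's `torusFourierInv_const`), of `c·H` (`momentSum_const_mul_le`);
* §2 **`norm_iteratedFDeriv_symInterp_treeData_le`** — for every `t ∈ [0,1]`: `‖Dʲ[evalM symInterp(Re T_t)](q)‖, ‖Dʲ[evalM symInterp(Im T_t)](q)‖ ≤ A_tree`,
  `A_tree = 4·(2·(2·(2|β|L²S_j²·G)) + L²Lʲ·A₀·(2|β|L²S_s²)/(1+L/4)ˢ)`, `G = 3ʲ·D_g·(2/N)^{M−j−4}·4C₂`, from the two-leg moments `S_j, S_s` of `𝒲_t` at the strings;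
* §3 **`norm_iteratedFDeriv_symInterp_dressingData_le`** — `‖Dʲ[evalM symInterp(¼Σ_σΣ_{i∈I} Re(A_i + B_i·Σ′_i))](q)‖ ≤ 2·|I|·(dressed bound for `a` with `H = ¼`
  + dressed bound for `b` with `H = ¼Σ′`)`.

Proofs only; no definitions; nothing about `s₀, s₁, Σ′`, the sizes of `𝒲_t` or the model is asserted; the flow-frame instantiation (`s₀ = Ψ_{K_m}`, `s₁ = Ψ̃`,
`g = d`, `a = J₂`, `b = J₁`, tables `…EngineFrameShiftDressingFactorTables`) is the sequel.  Nothing asserts superconductivity.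
References: BGM 2006 §2.3 (2.17), (2.21)–(2.24), §3 (3.3) [cite: BenfattoGiulianiMastropietro2006]; FST 1996 §1; Boyd 2001 §4.5 [cite: Boyd2001].
-/

noncomputable section

namespace Summit.HubbardSuperconductivity.HubbardSuperconductivity.Theorems.EngineV8

set_option linter.dupNamespace false -- summit = problem name (single-conjunct summit), D-0017

open Real Finset Filter Literature.MathematicalPhysics.QuantumLattice Literature.Probability.LatticeModels GrassmannAlgebra
open Summit.HubbardSuperconductivity.HubbardSuperconductivity.Theorems.KLRegimeSplit
open Summit.HubbardSuperconductivity.HubbardSuperconductivity.Theorems.TwoVolumeDefect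
open scoped ComplexConjugate

variable {L M : ℕ} [NeZero L]

/-! ## §1 The tree term is a product; moments of products and constants -/

/-- **The tree term of the response at the string `((i,k),σ)` is a product**:
`Σ[(𝒲_t,𝒲_t)_ḋ]((i,k),σ) = (2!·(βL²)¹)·(4·(s₁−s₀)((i,k),σ)·R_t((i,k),σ)²)`, `𝒲_t = 𝒲′[s₀ + t(s₁−s₀)]`. [cite: BenfattoGiulianiMastropietro2006, §2.3 (2.21)] -/
theorem selfEnergy_derivPairing_eq (s₀ s₁ : FreqMomentum L M × Fin 2 → ℂ) (β U : ℝ) (K : TrigPolyC4v) (t : ℝ) (i : MatsubaraIdx M)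
    (kv : TorusSite 2 L) (σ : Fin 2) :
    selfEnergy L M β (grassmannDerivPairing ℂ (normalCovariance L M s₁ - normalCovariance L M s₀)
        (effAction ℂ (normalCovariance L M s₀ + ((t : ℂ)) • (normalCovariance L M s₁ - normalCovariance L M s₀))
          (hubbardInteraction L M β U + counterQuadratic L M β K))
        (effAction ℂ (normalCovariance L M s₀ + ((t : ℂ)) • (normalCovariance L M s₁ - normalCovariance L M s₀))
          (hubbardInteraction L M β U + counterQuadratic L M β K))) (i, kv) σ =
      ((((Nat.factorial 2 : ℕ) : ℝ) * (β * (L : ℝ) ^ 2) ^ (2 - 1) : ℝ) : ℂ) * (4 * (s₁ ((i, kv), σ) - s₀ ((i, kv), σ)) *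
        kernel ℂ (effAction ℂ (normalCovariance L M s₀ + ((t : ℂ)) • (normalCovariance L M s₁ - normalCovariance L M s₀))
          (hubbardInteraction L M β U + counterQuadratic L M β K)) 2 ![((((i, kv), σ), 0) : HubbardFieldIdx L M), (((i, kv), σ), 1)] ^ 2) := by
  rw [selfEnergy, vertexFn, normalCovariance_linePath, normalCovariance_sub,
    covRespCT_kernel_two_pairing_eq β U K (fun p => s₁ p - s₀ p) (fun p => s₀ p + (t : ℂ) * (s₁ p - s₀ p)) ((i, kv), σ)]

/-- Moments of a constant times a lattice factor. -/
theorem momentSum_const_mul_le (c : ℂ) (H : TorusSite 2 L → ℂ) (r : ℕ) {S : ℝ}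
    (hS : ∑ x : TorusSite 2 L, (1 + ((x 0).valMinAbs.natAbs : ℝ) + ((x 1).valMinAbs.natAbs : ℝ)) ^ r * ‖torusFourierInv H x‖ ≤ S) :
    ∑ x : TorusSite 2 L, (1 + ((x 0).valMinAbs.natAbs : ℝ) + ((x 1).valMinAbs.natAbs : ℝ)) ^ r * ‖torusFourierInv (fun k => c * H k) x‖ ≤ ‖c‖ * S := by
  simp_rw [torusFourierInv_const_mul, norm_mul, mul_left_comm _ ‖c‖, ← mul_sum]
  exact mul_le_mul_of_nonneg_left hS (norm_nonneg _)

/-- **Moments of `C·R²` from moments of `R`** (Young for the weighted convolution, submultiplicative weight). [cite: BenfattoGiulianiMastropietro2006, §3 (3.3)] -/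
theorem momentSum_const_mul_sq_le (C : ℂ) (R : TorusSite 2 L → ℂ) (r : ℕ) {S : ℝ}
    (hS : ∑ x : TorusSite 2 L, (1 + ((x 0).valMinAbs.natAbs : ℝ) + ((x 1).valMinAbs.natAbs : ℝ)) ^ r * ‖torusFourierInv R x‖ ≤ S) :
    ∑ x : TorusSite 2 L, (1 + ((x 0).valMinAbs.natAbs : ℝ) + ((x 1).valMinAbs.natAbs : ℝ)) ^ r * ‖torusFourierInv (fun k => C * R k ^ 2) x‖ ≤
      ‖C‖ * S ^ 2 := by
  have hS0 : 0 ≤ S := le_trans (sum_nonneg fun x _ => mul_nonneg (by positivity) (norm_nonneg _)) hS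
  have hsq : (fun k => C * R k ^ 2) = fun k => C * (R k * R k) := by funext k; ring
  rw [hsq]
  refine (momentSum_const_mul_le C (fun k => R k * R k) r le_rfl).trans (mul_le_mul_of_nonneg_left ?_ (norm_nonneg _))
  refine (sum_mul_norm_torusFourierInv_mul_le (w := fun x : TorusSite 2 L => (1 + ((x 0).valMinAbs.natAbs : ℝ) + ((x 1).valMinAbs.natAbs : ℝ)) ^ r)
    (fun x => by positivity) (fun x y => momentWeight₂_pow_add_le r x y) R R).trans ?_
  rw [sq]
  exact mul_le_mul hS hS (sum_nonneg fun x _ => mul_nonneg (by positivity) (norm_nonneg _)) hS0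

/-- Moments of a constant lattice factor: `Σ_x (1+|x̃|)ʳ‖𝔉⁻¹[c](x)‖ = ‖c‖`. -/
theorem momentSum_torusFourierInv_const (c : ℂ) (r : ℕ) :
    ∑ x : TorusSite 2 L, (1 + ((x 0).valMinAbs.natAbs : ℝ) + ((x 1).valMinAbs.natAbs : ℝ)) ^ r * ‖torusFourierInv (fun _ : TorusSite 2 L => c) x‖ = ‖c‖ := by
  simp_rw [torusFourierInv_const]
  rw [Finset.sum_eq_single (0 : TorusSite 2 L)]
  · simp
  · intro x _ hx; rw [if_neg hx, norm_zero, mul_zero]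
  · intro h; exact absurd (mem_univ _) h

/-- `Im z = Re(−I·z)`. -/
theorem im_eq_re_negI_mul (z : ℂ) : z.im = (-Complex.I * z).re := by simp

/-! ## §2 The TREE jets of the corrected (B) door are pure aliasing -/

/-- **THE TREE JETS `A, A′` OF THE CORRECTED (B) DOOR ARE PURE ALIASING.**  Abstract symbols `s₀, s₁` whose difference on the two reading frequencies
is the sampled continuum factor `g_i` (smooth, `2π`-periodic, `D₄`-symmetric, vanishing near `q`, `‖D^{Md} g_i‖ ≤ D_g`, `‖g_i‖ ≤ A₀`, `4 + j ≤ Md`), and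
two-leg `(1+|x̃|)`-moments `S_j, S_s` of `𝒲_t = 𝒲′[s₀ + t(s₁−s₀)]` at the strings `((i,·),σ)`: for every `t ∈ [0,1]` both the real and the imaginary tree datum have
`‖Dʲ[evalM symInterp(·)](q)‖ ≤ 4·(2·(2·(2|β|L²S_j²·(3ʲD_g(2/N)^{Md−j−4}·4C₂))) + L²Lʲ·(A₀·(2|β|L²S_s²/(1+L/4)ˢ)))`. [cite: BenfattoGiulianiMastropietro2006, §2.3 (2.21)–(2.24)] -/
theorem norm_iteratedFDeriv_symInterp_treeData_le (s₀ s₁ : FreqMomentum L M × Fin 2 → ℂ) (β U : ℝ) (K : TrigPolyC4v) (i₁ i₂ : MatsubaraIdx M)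
    {g : MatsubaraIdx M → Momentum → ℂ}
    (hs : ∀ i ∈ ({i₁, i₂} : Finset (MatsubaraIdx M)), ∀ (kv : TorusSite 2 L) (σ : Fin 2),
      s₁ ((i, kv), σ) - s₀ ((i, kv), σ) = g i (WithLp.toLp 2 (latticeMomentum L kv)))
    (hgper : ∀ i ∈ ({i₁, i₂} : Finset (MatsubaraIdx M)), ∀ (c : Fin 2) (q : Momentum), g i (q + EuclideanSpace.single c (2 * π)) = g i q)
    (hg : ∀ i ∈ ({i₁, i₂} : Finset (MatsubaraIdx M)), ContDiff ℝ (⊤ : ℕ∞) (g i))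
    (hrefl : ∀ i ∈ ({i₁, i₂} : Finset (MatsubaraIdx M)), ∀ p : Fin 2 → ℝ, g i (WithLp.toLp 2 ![p 0, -p 1]) = g i (WithLp.toLp 2 p))
    (hswap : ∀ i ∈ ({i₁, i₂} : Finset (MatsubaraIdx M)), ∀ p : Fin 2 → ℝ, g i (WithLp.toLp 2 ![p 1, p 0]) = g i (WithLp.toLp 2 p))
    {j Md : ℕ} (hM : 4 + j ≤ Md) {Dg A₀ : ℝ} (hDg : ∀ i ∈ ({i₁, i₂} : Finset (MatsubaraIdx M)), ∀ q, ‖iteratedFDeriv ℝ Md (g i) q‖ ≤ Dg)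
    (hA₀ : ∀ i ∈ ({i₁, i₂} : Finset (MatsubaraIdx M)), ∀ q, ‖g i q‖ ≤ A₀)
    {q : Momentum} (hvan : ∀ i ∈ ({i₁, i₂} : Finset (MatsubaraIdx M)), ∀ᶠ q' in nhds q, g i q' = 0)
    {s : ℕ} {Sj Ss : ℝ}
    (hR : ∀ t ∈ Set.Icc (0 : ℝ) 1, ∀ i ∈ ({i₁, i₂} : Finset (MatsubaraIdx M)), ∀ σ : Fin 2,
      (∑ x : TorusSite 2 L, (1 + ((x 0).valMinAbs.natAbs : ℝ) + ((x 1).valMinAbs.natAbs : ℝ)) ^ j * ‖torusFourierInv (fun kv : TorusSite 2 L =>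
        kernel ℂ (effAction ℂ (normalCovariance L M s₀ + ((t : ℂ)) • (normalCovariance L M s₁ - normalCovariance L M s₀))
          (hubbardInteraction L M β U + counterQuadratic L M β K)) 2 ![((((i, kv), σ), 0) : HubbardFieldIdx L M), (((i, kv), σ), 1)]) x‖ ≤ Sj) ∧
      (∑ x : TorusSite 2 L, (1 + ((x 0).valMinAbs.natAbs : ℝ) + ((x 1).valMinAbs.natAbs : ℝ)) ^ s * ‖torusFourierInv (fun kv : TorusSite 2 L =>
        kernel ℂ (effAction ℂ (normalCovariance L M s₀ + ((t : ℂ)) • (normalCovariance L M s₁ - normalCovariance L M s₀))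
          (hubbardInteraction L M β U + counterQuadratic L M β K)) 2 ![((((i, kv), σ), 0) : HubbardFieldIdx L M), (((i, kv), σ), 1)]) x‖ ≤ Ss)) :
    ∀ t ∈ Set.Icc (0 : ℝ) 1,
      ‖iteratedFDeriv ℝ j (evalM (symInterp L (fun kv : TorusSite 2 L => ((∑ σ : Fin 2,
        (selfEnergy L M β (grassmannDerivPairing ℂ (normalCovariance L M s₁ - normalCovariance L M s₀)
            (effAction ℂ (normalCovariance L M s₀ + ((t : ℂ)) • (normalCovariance L M s₁ - normalCovariance L M s₀))
              (hubbardInteraction L M β U + counterQuadratic L M β K))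
            (effAction ℂ (normalCovariance L M s₀ + ((t : ℂ)) • (normalCovariance L M s₁ - normalCovariance L M s₀))
              (hubbardInteraction L M β U + counterQuadratic L M β K))) (i₁, kv) σ +
          selfEnergy L M β (grassmannDerivPairing ℂ (normalCovariance L M s₁ - normalCovariance L M s₀)
            (effAction ℂ (normalCovariance L M s₀ + ((t : ℂ)) • (normalCovariance L M s₁ - normalCovariance L M s₀))
              (hubbardInteraction L M β U + counterQuadratic L M β K))
            (effAction ℂ (normalCovariance L M s₀ + ((t : ℂ)) • (normalCovariance L M s₁ - normalCovariance L M s₀))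
              (hubbardInteraction L M β U + counterQuadratic L M β K))) (i₂, kv) σ)) / 4).re))) q‖ ≤
        4 * (2 * (2 * ((2 * |β| * (L : ℝ) ^ 2 * Sj ^ 2) * ((3 : ℝ) ^ j * Dg * (2 / ((2 * (L / 4 + 1) : ℕ) : ℝ)) ^ (Md - j - 4) *
          (2 ^ 2 * ∑' k : Fin 2 → ℤ, ∏ c, (1 + (k c : ℝ) ^ 2)⁻¹)))) +
          (L : ℝ) ^ 2 * (L : ℝ) ^ j * (A₀ * ((2 * |β| * (L : ℝ) ^ 2 * Ss ^ 2) / (1 + (L : ℝ) / 4) ^ s))) ∧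
      ‖iteratedFDeriv ℝ j (evalM (symInterp L (fun kv : TorusSite 2 L => ((∑ σ : Fin 2,
        (selfEnergy L M β (grassmannDerivPairing ℂ (normalCovariance L M s₁ - normalCovariance L M s₀)
            (effAction ℂ (normalCovariance L M s₀ + ((t : ℂ)) • (normalCovariance L M s₁ - normalCovariance L M s₀))
              (hubbardInteraction L M β U + counterQuadratic L M β K))
            (effAction ℂ (normalCovariance L M s₀ + ((t : ℂ)) • (normalCovariance L M s₁ - normalCovariance L M s₀))
              (hubbardInteraction L M β U + counterQuadratic L M β K))) (i₁, kv) σ +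
          selfEnergy L M β (grassmannDerivPairing ℂ (normalCovariance L M s₁ - normalCovariance L M s₀)
            (effAction ℂ (normalCovariance L M s₀ + ((t : ℂ)) • (normalCovariance L M s₁ - normalCovariance L M s₀))
              (hubbardInteraction L M β U + counterQuadratic L M β K))
            (effAction ℂ (normalCovariance L M s₀ + ((t : ℂ)) • (normalCovariance L M s₁ - normalCovariance L M s₀))
              (hubbardInteraction L M β U + counterQuadratic L M β K))) (i₂, kv) σ)) / 4).im))) q‖ ≤
        4 * (2 * (2 * ((2 * |β| * (L : ℝ) ^ 2 * Sj ^ 2) * ((3 : ℝ) ^ j * Dg * (2 / ((2 * (L / 4 + 1) : ℕ) : ℝ)) ^ (Md - j - 4) *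
          (2 ^ 2 * ∑' k : Fin 2 → ℤ, ∏ c, (1 + (k c : ℝ) ^ 2)⁻¹)))) +
          (L : ℝ) ^ 2 * (L : ℝ) ^ j * (A₀ * ((2 * |β| * (L : ℝ) ^ 2 * Ss ^ 2) / (1 + (L : ℝ) / 4) ^ s))) := by
  intro t ht
  have hi₁ : i₁ ∈ ({i₁, i₂} : Finset (MatsubaraIdx M)) := by simp
  have hi₂ : i₂ ∈ ({i₁, i₂} : Finset (MatsubaraIdx M)) := by simp
  -- abbreviations
  set W := effAction ℂ (normalCovariance L M s₀ + ((t : ℂ)) • (normalCovariance L M s₁ - normalCovariance L M s₀))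
    (hubbardInteraction L M β U + counterQuadratic L M β K) with hW
  set C : ℂ := ((((Nat.factorial 2 : ℕ) : ℝ) * (β * (L : ℝ) ^ 2) ^ (2 - 1) : ℝ) : ℂ) with hC
  set R : MatsubaraIdx M → Fin 2 → TorusSite 2 L → ℂ := fun i σ kv =>
    kernel ℂ W 2 ![((((i, kv), σ), 0) : HubbardFieldIdx L M), (((i, kv), σ), 1)] with hR'
  set Gb : ℝ := (3 : ℝ) ^ j * Dg * (2 / ((2 * (L / 4 + 1) : ℕ) : ℝ)) ^ (Md - j - 4) * (2 ^ 2 * ∑' k : Fin 2 → ℤ, ∏ c, (1 + (k c : ℝ) ^ 2)⁻¹) with hGb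
  have hCnorm : ‖C‖ = 2 * |β| * (L : ℝ) ^ 2 := by
    rw [hC, Complex.norm_real, Real.norm_eq_abs]
    simp [Nat.factorial, abs_mul, mul_assoc]
  -- the tree term as a product, at both frequencies
  have hSE : ∀ i ∈ ({i₁, i₂} : Finset (MatsubaraIdx M)), ∀ (kv : TorusSite 2 L) (σ : Fin 2),
      selfEnergy L M β (grassmannDerivPairing ℂ (normalCovariance L M s₁ - normalCovariance L M s₀) W W) (i, kv) σ =
        g i (WithLp.toLp 2 (latticeMomentum L kv)) * (C * (4 * R i σ kv ^ 2)) := by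
    intro i hi kv σ
    rw [hW, selfEnergy_derivPairing_eq s₀ s₁ β U K t i kv σ, hs i hi kv σ]
    ring
  -- one dressed term
  have hterm : ∀ i ∈ ({i₁, i₂} : Finset (MatsubaraIdx M)), ∀ σ : Fin 2, ∀ c : ℂ, ‖c‖ = 1 →
      ‖iteratedFDeriv ℝ j (evalM (symInterp L (fun kv : TorusSite 2 L =>
        (g i (WithLp.toLp 2 (latticeMomentum L kv)) * ((c * C) * R i σ kv ^ 2)).re))) q‖ ≤
        2 * (2 * ((2 * |β| * (L : ℝ) ^ 2 * Sj ^ 2) * Gb)) + (L : ℝ) ^ 2 * (L : ℝ) ^ j * (A₀ * ((2 * |β| * (L : ℝ) ^ 2 * Ss ^ 2) / (1 + (L : ℝ) / 4) ^ s)) := by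
    intro i hi σ c hc
    have hcC : ‖c * C‖ = 2 * |β| * (L : ℝ) ^ 2 := by rw [norm_mul, hc, one_mul, hCnorm]
    have hMj := momentSum_const_mul_sq_le (c * C) (R i σ) j (hR t ht i hi σ).1
    have hMs := momentSum_const_mul_sq_le (c * C) (R i σ) s (hR t ht i hi σ).2
    rw [hcC] at hMj hMs
    exact norm_iteratedFDeriv_evalM_symInterp_dressed_le (hgper i hi) (hg i hi) (hrefl i hi) (hswap i hi) (fun kv => (c * C) * R i σ kv ^ 2)
      hM (hDg i hi) (hA₀ i hi) hMj hMs (hvan i hi)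
  -- the two data functions as sums of dressed terms
  have hre : (fun kv : TorusSite 2 L => ((∑ σ : Fin 2,
      (selfEnergy L M β (grassmannDerivPairing ℂ (normalCovariance L M s₁ - normalCovariance L M s₀) W W) (i₁, kv) σ +
        selfEnergy L M β (grassmannDerivPairing ℂ (normalCovariance L M s₁ - normalCovariance L M s₀) W W) (i₂, kv) σ)) / 4).re) =
      fun kv => ∑ σ : Fin 2, ((g i₁ (WithLp.toLp 2 (latticeMomentum L kv)) * ((1 * C) * R i₁ σ kv ^ 2)).re +
        (g i₂ (WithLp.toLp 2 (latticeMomentum L kv)) * ((1 * C) * R i₂ σ kv ^ 2)).re) := by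
    funext kv
    rw [sum_div, Complex.re_sum]
    refine sum_congr rfl fun σ _ => ?_
    rw [hSE i₁ hi₁ kv σ, hSE i₂ hi₂ kv σ, ← Complex.add_re]
    congr 1
    ring
  have him : (fun kv : TorusSite 2 L => ((∑ σ : Fin 2,
      (selfEnergy L M β (grassmannDerivPairing ℂ (normalCovariance L M s₁ - normalCovariance L M s₀) W W) (i₁, kv) σ +
        selfEnergy L M β (grassmannDerivPairing ℂ (normalCovariance L M s₁ - normalCovariance L M s₀) W W) (i₂, kv) σ)) / 4).im) =
      fun kv => ∑ σ : Fin 2, ((g i₁ (WithLp.toLp 2 (latticeMomentum L kv)) * ((-Complex.I * C) * R i₁ σ kv ^ 2)).re +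
        (g i₂ (WithLp.toLp 2 (latticeMomentum L kv)) * ((-Complex.I * C) * R i₂ σ kv ^ 2)).re) := by
    funext kv
    rw [im_eq_re_negI_mul, ← mul_div_assoc, mul_sum, sum_div, Complex.re_sum]
    refine sum_congr rfl fun σ _ => ?_
    rw [hSE i₁ hi₁ kv σ, hSE i₂ hi₂ kv σ, ← Complex.add_re]
    congr 1
    ring
  -- splitting the jets over the finite sums
  have hsplit : ∀ c : ℂ, ‖c‖ = 1 →
      ‖iteratedFDeriv ℝ j (evalM (symInterp L (fun kv => ∑ σ : Fin 2,
        ((g i₁ (WithLp.toLp 2 (latticeMomentum L kv)) * ((c * C) * R i₁ σ kv ^ 2)).re +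
          (g i₂ (WithLp.toLp 2 (latticeMomentum L kv)) * ((c * C) * R i₂ σ kv ^ 2)).re)))) q‖ ≤
        4 * (2 * (2 * ((2 * |β| * (L : ℝ) ^ 2 * Sj ^ 2) * Gb)) + (L : ℝ) ^ 2 * (L : ℝ) ^ j * (A₀ * ((2 * |β| * (L : ℝ) ^ 2 * Ss ^ 2) / (1 + (L : ℝ) / 4) ^ s))) := by
    intro c hc
    have hfun : evalM (symInterp L (fun kv => ∑ σ : Fin 2,
        ((g i₁ (WithLp.toLp 2 (latticeMomentum L kv)) * ((c * C) * R i₁ σ kv ^ 2)).re +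
          (g i₂ (WithLp.toLp 2 (latticeMomentum L kv)) * ((c * C) * R i₂ σ kv ^ 2)).re))) =
        fun q' => ∑ σ : Fin 2, (evalM (symInterp L (fun kv => (g i₁ (WithLp.toLp 2 (latticeMomentum L kv)) * ((c * C) * R i₁ σ kv ^ 2)).re)) q' +
          evalM (symInterp L (fun kv => (g i₂ (WithLp.toLp 2 (latticeMomentum L kv)) * ((c * C) * R i₂ σ kv ^ 2)).re)) q') := by
      funext q'
      rw [evalM_apply, eval_symInterp_finset_sum L univ]
      refine sum_congr rfl fun σ _ => ?_
      rw [eval_symInterp_add L]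
      rfl
    have hcd : ∀ f : TorusSite 2 L → ℝ, ContDiff ℝ j (evalM (symInterp L f)) := fun f => contDiff_evalM _
    rw [hfun, iteratedFDeriv_fun_sum_apply fun σ _ => ((hcd _).add (hcd _)).contDiffAt]
    refine (norm_sum_le _ _).trans ?_
    calc ∑ σ : Fin 2, ‖iteratedFDeriv ℝ j (fun q' =>
            evalM (symInterp L (fun kv => (g i₁ (WithLp.toLp 2 (latticeMomentum L kv)) * ((c * C) * R i₁ σ kv ^ 2)).re)) q' +
            evalM (symInterp L (fun kv => (g i₂ (WithLp.toLp 2 (latticeMomentum L kv)) * ((c * C) * R i₂ σ kv ^ 2)).re)) q') q‖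
        ≤ ∑ _σ : Fin 2, ((2 * (2 * ((2 * |β| * (L : ℝ) ^ 2 * Sj ^ 2) * Gb)) +
            (L : ℝ) ^ 2 * (L : ℝ) ^ j * (A₀ * ((2 * |β| * (L : ℝ) ^ 2 * Ss ^ 2) / (1 + (L : ℝ) / 4) ^ s))) +
            (2 * (2 * ((2 * |β| * (L : ℝ) ^ 2 * Sj ^ 2) * Gb)) +
            (L : ℝ) ^ 2 * (L : ℝ) ^ j * (A₀ * ((2 * |β| * (L : ℝ) ^ 2 * Ss ^ 2) / (1 + (L : ℝ) / 4) ^ s)))) := by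
          refine sum_le_sum fun σ _ => ?_
          rw [fun_iteratedFDeriv_add_apply (hcd _).contDiffAt (hcd _).contDiffAt]
          exact (norm_add_le _ _).trans (add_le_add (hterm i₁ hi₁ σ c hc) (hterm i₂ hi₂ σ c hc))
      _ = 4 * (2 * (2 * ((2 * |β| * (L : ℝ) ^ 2 * Sj ^ 2) * Gb)) +
            (L : ℝ) ^ 2 * (L : ℝ) ^ j * (A₀ * ((2 * |β| * (L : ℝ) ^ 2 * Ss ^ 2) / (1 + (L : ℝ) / 4) ^ s))) := by
          rw [sum_const, Finset.card_univ, Fintype.card_fin, nsmul_eq_mul]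
          push_cast
          ring
  refine ⟨?_, ?_⟩
  · rw [hre]; exact hsplit 1 norm_one
  · rw [him]; exact hsplit (-Complex.I) (by simp)

/-! ## §3 The DRESSING jets of the corrected (B) door are pure aliasing -/

/-- **THE DRESSING JETS `A_J` OF THE CORRECTED (B) DOOR ARE PURE ALIASING.**  Lattice dressing data `A_i(k,σ) = a_i(p_k)`, `B_i(k,σ) = b_i(p_k)` on a finite
set `I` of frequencies, with continuum factors `a_i, b_i` smooth, `2π`-periodic, `D₄`-symmetric, vanishing near `q` (`‖D^{Md}·‖ ≤ D_a, D_b`, `‖·‖ ≤ A_a, A_b`,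
`4 + j ≤ Md`), and an arbitrary lattice factor `Σ′` with `(1+|x̃|)`-moments `S_j′, S_s′` at the strings:
`‖Dʲ[evalM symInterp(k ↦ ¼·Re Σ_σΣ_{i∈I}(A_i(k,σ) + B_i(k,σ)·Σ′((i,k),σ)))](q)‖ ≤ 2|I|·([a-term, H = ¼] + [b-term, H = ¼Σ′])`.
[cite: BenfattoGiulianiMastropietro2006, §2.3 (2.23)] -/
theorem norm_iteratedFDeriv_symInterp_dressingData_le (I : Finset (MatsubaraIdx M)) (A B : MatsubaraIdx M → TorusSite 2 L → Fin 2 → ℂ)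
    (SE : FreqMomentum L M → Fin 2 → ℂ) {a b : MatsubaraIdx M → Momentum → ℂ}
    (hA : ∀ i ∈ I, ∀ (kv : TorusSite 2 L) (σ : Fin 2), A i kv σ = a i (WithLp.toLp 2 (latticeMomentum L kv)))
    (hB : ∀ i ∈ I, ∀ (kv : TorusSite 2 L) (σ : Fin 2), B i kv σ = b i (WithLp.toLp 2 (latticeMomentum L kv)))
    (haper : ∀ i ∈ I, ∀ (c : Fin 2) (q : Momentum), a i (q + EuclideanSpace.single c (2 * π)) = a i q)
    (hbper : ∀ i ∈ I, ∀ (c : Fin 2) (q : Momentum), b i (q + EuclideanSpace.single c (2 * π)) = b i q)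
    (ha : ∀ i ∈ I, ContDiff ℝ (⊤ : ℕ∞) (a i)) (hb : ∀ i ∈ I, ContDiff ℝ (⊤ : ℕ∞) (b i))
    (harefl : ∀ i ∈ I, ∀ p : Fin 2 → ℝ, a i (WithLp.toLp 2 ![p 0, -p 1]) = a i (WithLp.toLp 2 p))
    (haswap : ∀ i ∈ I, ∀ p : Fin 2 → ℝ, a i (WithLp.toLp 2 ![p 1, p 0]) = a i (WithLp.toLp 2 p))
    (hbrefl : ∀ i ∈ I, ∀ p : Fin 2 → ℝ, b i (WithLp.toLp 2 ![p 0, -p 1]) = b i (WithLp.toLp 2 p))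
    (hbswap : ∀ i ∈ I, ∀ p : Fin 2 → ℝ, b i (WithLp.toLp 2 ![p 1, p 0]) = b i (WithLp.toLp 2 p))
    {j Md : ℕ} (hM : 4 + j ≤ Md) {Da Db Aa Ab : ℝ}
    (hDa : ∀ i ∈ I, ∀ q, ‖iteratedFDeriv ℝ Md (a i) q‖ ≤ Da) (hDb : ∀ i ∈ I, ∀ q, ‖iteratedFDeriv ℝ Md (b i) q‖ ≤ Db)
    (hAa : ∀ i ∈ I, ∀ q, ‖a i q‖ ≤ Aa) (hAb : ∀ i ∈ I, ∀ q, ‖b i q‖ ≤ Ab)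
    {q : Momentum} (havan : ∀ i ∈ I, ∀ᶠ q' in nhds q, a i q' = 0) (hbvan : ∀ i ∈ I, ∀ᶠ q' in nhds q, b i q' = 0)
    {s : ℕ} {Sj Ss : ℝ}
    (hS : ∀ i ∈ I, ∀ σ : Fin 2,
      (∑ x : TorusSite 2 L, (1 + ((x 0).valMinAbs.natAbs : ℝ) + ((x 1).valMinAbs.natAbs : ℝ)) ^ j *
          ‖torusFourierInv (fun kv : TorusSite 2 L => SE (i, kv) σ) x‖ ≤ Sj) ∧
      (∑ x : TorusSite 2 L, (1 + ((x 0).valMinAbs.natAbs : ℝ) + ((x 1).valMinAbs.natAbs : ℝ)) ^ s *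
          ‖torusFourierInv (fun kv : TorusSite 2 L => SE (i, kv) σ) x‖ ≤ Ss)) :
    ‖iteratedFDeriv ℝ j (evalM (symInterp L (fun kv : TorusSite 2 L =>
        (∑ σ : Fin 2, ∑ i ∈ I, (A i kv σ + B i kv σ * SE (i, kv) σ)).re / 4))) q‖ ≤
      2 * I.card * ((2 * (2 * ((1 / 4 : ℝ) * ((3 : ℝ) ^ j * Da * (2 / ((2 * (L / 4 + 1) : ℕ) : ℝ)) ^ (Md - j - 4) *
          (2 ^ 2 * ∑' k : Fin 2 → ℤ, ∏ c, (1 + (k c : ℝ) ^ 2)⁻¹)))) + (L : ℝ) ^ 2 * (L : ℝ) ^ j * (Aa * ((1 / 4 : ℝ) / (1 + (L : ℝ) / 4) ^ s))) +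
        (2 * (2 * ((1 / 4 * Sj) * ((3 : ℝ) ^ j * Db * (2 / ((2 * (L / 4 + 1) : ℕ) : ℝ)) ^ (Md - j - 4) *
          (2 ^ 2 * ∑' k : Fin 2 → ℤ, ∏ c, (1 + (k c : ℝ) ^ 2)⁻¹)))) + (L : ℝ) ^ 2 * (L : ℝ) ^ j * (Ab * ((1 / 4 * Ss) / (1 + (L : ℝ) / 4) ^ s)))) := by
  classical
  set c₄ : ℂ := (((1 / 4 : ℝ)) : ℂ) with hc₄
  have hc₄n : ‖c₄‖ = 1 / 4 := by rw [hc₄, Complex.norm_real, Real.norm_eq_abs, abs_of_pos (by norm_num)]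
  -- the data as a double sum of dressed terms
  have hdata : (fun kv : TorusSite 2 L => (∑ σ : Fin 2, ∑ i ∈ I, (A i kv σ + B i kv σ * SE (i, kv) σ)).re / 4) =
      fun kv => ∑ σ : Fin 2, ∑ i ∈ I, ((a i (WithLp.toLp 2 (latticeMomentum L kv)) * c₄).re +
        (b i (WithLp.toLp 2 (latticeMomentum L kv)) * (c₄ * SE (i, kv) σ)).re) := by
    funext kv
    have hdiv : ∀ z : ℂ, z.re / 4 = (c₄ * z).re := fun z => by rw [hc₄, Complex.re_ofReal_mul]; ring
    rw [hdiv, mul_sum, Complex.re_sum]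
    refine sum_congr rfl fun σ _ => ?_
    rw [mul_sum, Complex.re_sum]
    refine sum_congr rfl fun i hi => ?_
    rw [hA i hi kv σ, hB i hi kv σ, ← Complex.add_re]
    congr 1
    ring
  have hfun : evalM (symInterp L (fun kv => ∑ σ : Fin 2, ∑ i ∈ I, ((a i (WithLp.toLp 2 (latticeMomentum L kv)) * c₄).re +
        (b i (WithLp.toLp 2 (latticeMomentum L kv)) * (c₄ * SE (i, kv) σ)).re))) =
      fun q' => ∑ σ : Fin 2, ∑ i ∈ I, (evalM (symInterp L (fun kv => (a i (WithLp.toLp 2 (latticeMomentum L kv)) * c₄).re)) q' +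
        evalM (symInterp L (fun kv => (b i (WithLp.toLp 2 (latticeMomentum L kv)) * (c₄ * SE (i, kv) σ)).re)) q') := by
    funext q'
    rw [evalM_apply, eval_symInterp_finset_sum L univ]
    refine sum_congr rfl fun σ _ => ?_
    rw [eval_symInterp_finset_sum L I]
    refine sum_congr rfl fun i _ => ?_
    rw [eval_symInterp_add L]
    rfl
  have hcd : ∀ f : TorusSite 2 L → ℝ, ContDiff ℝ j (evalM (symInterp L f)) := fun f => contDiff_evalM _
  -- the two dressed bounds
  have ha_term : ∀ i ∈ I, ‖iteratedFDeriv ℝ j (evalM (symInterp L (fun kv => (a i (WithLp.toLp 2 (latticeMomentum L kv)) * c₄).re))) q‖ ≤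
      2 * (2 * ((1 / 4 : ℝ) * ((3 : ℝ) ^ j * Da * (2 / ((2 * (L / 4 + 1) : ℕ) : ℝ)) ^ (Md - j - 4) *
          (2 ^ 2 * ∑' k : Fin 2 → ℤ, ∏ c, (1 + (k c : ℝ) ^ 2)⁻¹)))) + (L : ℝ) ^ 2 * (L : ℝ) ^ j * (Aa * ((1 / 4 : ℝ) / (1 + (L : ℝ) / 4) ^ s)) := by
    intro i hi
    have hMj := momentSum_torusFourierInv_const (L := L) c₄ j
    have hMs := momentSum_torusFourierInv_const (L := L) c₄ s
    rw [hc₄n] at hMj hMs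
    exact norm_iteratedFDeriv_evalM_symInterp_dressed_le (haper i hi) (ha i hi) (harefl i hi) (haswap i hi) (fun _ => c₄)
      hM (hDa i hi) (hAa i hi) hMj.le hMs.le (havan i hi)
  have hb_term : ∀ i ∈ I, ∀ σ : Fin 2,
      ‖iteratedFDeriv ℝ j (evalM (symInterp L (fun kv => (b i (WithLp.toLp 2 (latticeMomentum L kv)) * (c₄ * SE (i, kv) σ)).re))) q‖ ≤
      2 * (2 * ((1 / 4 * Sj) * ((3 : ℝ) ^ j * Db * (2 / ((2 * (L / 4 + 1) : ℕ) : ℝ)) ^ (Md - j - 4) *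
          (2 ^ 2 * ∑' k : Fin 2 → ℤ, ∏ c, (1 + (k c : ℝ) ^ 2)⁻¹)))) + (L : ℝ) ^ 2 * (L : ℝ) ^ j * (Ab * ((1 / 4 * Ss) / (1 + (L : ℝ) / 4) ^ s)) := by
    intro i hi σ
    have hMj := momentSum_const_mul_le c₄ (fun kv => SE (i, kv) σ) j (hS i hi σ).1
    have hMs := momentSum_const_mul_le c₄ (fun kv => SE (i, kv) σ) s (hS i hi σ).2
    rw [hc₄n] at hMj hMs
    exact norm_iteratedFDeriv_evalM_symInterp_dressed_le (hbper i hi) (hb i hi) (hbrefl i hi) (hbswap i hi) (fun kv => c₄ * SE (i, kv) σ)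
      hM (hDb i hi) (hAb i hi) hMj hMs (hbvan i hi)
  rw [hdata, hfun, iteratedFDeriv_fun_sum_apply fun σ _ => (ContDiff.sum fun i _ => (hcd _).add (hcd _)).contDiffAt]
  refine (norm_sum_le _ _).trans ?_
  have hinner : ∀ σ : Fin 2, ‖iteratedFDeriv ℝ j (fun q' => ∑ i ∈ I,
      (evalM (symInterp L (fun kv => (a i (WithLp.toLp 2 (latticeMomentum L kv)) * c₄).re)) q' +
        evalM (symInterp L (fun kv => (b i (WithLp.toLp 2 (latticeMomentum L kv)) * (c₄ * SE (i, kv) σ)).re)) q')) q‖ ≤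
      I.card * ((2 * (2 * ((1 / 4 : ℝ) * ((3 : ℝ) ^ j * Da * (2 / ((2 * (L / 4 + 1) : ℕ) : ℝ)) ^ (Md - j - 4) *
          (2 ^ 2 * ∑' k : Fin 2 → ℤ, ∏ c, (1 + (k c : ℝ) ^ 2)⁻¹)))) + (L : ℝ) ^ 2 * (L : ℝ) ^ j * (Aa * ((1 / 4 : ℝ) / (1 + (L : ℝ) / 4) ^ s))) +
        (2 * (2 * ((1 / 4 * Sj) * ((3 : ℝ) ^ j * Db * (2 / ((2 * (L / 4 + 1) : ℕ) : ℝ)) ^ (Md - j - 4) *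
          (2 ^ 2 * ∑' k : Fin 2 → ℤ, ∏ c, (1 + (k c : ℝ) ^ 2)⁻¹)))) + (L : ℝ) ^ 2 * (L : ℝ) ^ j * (Ab * ((1 / 4 * Ss) / (1 + (L : ℝ) / 4) ^ s)))) := by
    intro σ
    rw [iteratedFDeriv_fun_sum_apply fun i _ => ((hcd _).add (hcd _)).contDiffAt]
    refine (norm_sum_le _ _).trans ?_
    refine (sum_le_sum fun i hi => ?_).trans (le_of_eq (by rw [sum_const, nsmul_eq_mul]))
    rw [fun_iteratedFDeriv_add_apply (hcd _).contDiffAt (hcd _).contDiffAt]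
    exact (norm_add_le _ _).trans (add_le_add (ha_term i hi) (hb_term i hi σ))
  refine (sum_le_sum fun σ _ => hinner σ).trans (le_of_eq ?_)
  rw [sum_const, Finset.card_univ, Fintype.card_fin, nsmul_eq_mul]
  push_cast
  ring

end Summit.HubbardSuperconductivity.HubbardSuperconductivity.Theorems.EngineV8

end
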